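import Summits.AtomisticToContinuum.Crystallization.Theorems.ShellsToBarlowChart.Negative.Calibration

/-!
# `ShellsToBarlowChart` (stmt-AtomisticToContinuum-9227), negative side IV: the Hägg word is load-bearing

Part IV of the crux disprover's negative-side lemmas (`Cruxes/ShellsToBarlowChart/Disproof.lean`,
cycle 2; parts I–III: `Calibration.lean`, `ScaleWindow.lean`, `Tolerance.lean`).

The conclusion of the crux quantifies `∃ s, IsHaggSeq s ∧ …`.  The natural strengthening with the
word FIXED to `constHagg` — "every every-point-good `S` is bond-isomorphic to the FCC stacking"
(`FccChart S`) — is false: `not_shellsToFccChart` (statement inlined; the work file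
`Cruxes/ShellsToBarlowChart/Disproof.lean` names it `ShellsToFccChart`).  Witness: the ideal HCP stacking (hypothesis
by `hypothesis_barlowStacking`).  Invariant: its points `u = (layer 1, 0, 0)`, `l = (layer −1, 0, 0)`
(mirror images across layer `0`; `dist u l = 2√(2/3) > 28/25`, not bonded) have exactly THREE
common bonded neighbours — the triangle of layer `0` between them — whereas two distinct non-bonded
points of the FCC stacking have `4, 2, 1` or `0` (`fccCommonCount_ne_three`: a `decide` over the
`144` pairs of bond offsets in stacking coordinates, `fcc_dist_eq_one_iff`, `ncard_common_fcc`);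
a bond-isomorphism preserves these counts because the window pairs of an ideal stacking are exactly
its bonds (`dist_eq_of_dist_le_of_lt`, `28/25 < √2`).  So the word must be read off `S`.

All `[folklore]`; inputs: `BarlowCoordination.dist_barlowPos_eq_iff`,
`le_dist_barlowPos_of_ideal`, `BarlowRings.dist_eq_of_dist_le_of_lt`, part I.
-/

noncomputable section

namespace Summit.AtomisticToContinuum.Crystallization.Theorems.ShellsToBarlowChartNegative

open Literature.Geometry.DiscreteGeometry Literature.MathematicalPhysics.StatisticalMechanics
open Summit.AtomisticToContinuum.Crystallization.Theses.PalmUnimodularRigidity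

/-- Euclidean `3`-space. -/
local notation "E3" => EuclideanSpace ℝ (Fin 3)

section HaggWord

/-- FCC adjacency in stacking coordinates: relative layer `r = k' − k` and in-layer offset
`(P, Q) = (i − i', j − j')` of a bonded pair (`dist_barlowPos_eq_iff` for `s = constHagg`).
[folklore] -/
abbrev FccAdj (r P Q : ℤ) : Prop :=
  (r = 0 ∧ (P, Q) ∈ sixOffsets) ∨ (r = 1 ∧ (P, Q) ∈ threeOffsets (-1)) ∨
    (r = -1 ∧ (P, Q) ∈ threeOffsets 1)

/-- The twelve FCC bond offsets `(r, P, Q)`. [folklore] -/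
def fccNbr : Finset (ℤ × ℤ × ℤ) :=
  {(0, 1, 0), (0, -1, 0), (0, 0, 1), (0, 0, -1), (0, 1, -1), (0, -1, 1),
   (1, 0, 0), (1, 1, 0), (1, 0, 1), (-1, 0, 0), (-1, -1, 0), (-1, 0, -1)}

/-- `fccNbr` lists exactly the solutions of `FccAdj`. [folklore] -/
theorem mem_fccNbr_iff {t : ℤ × ℤ × ℤ} : t ∈ fccNbr ↔ FccAdj t.1 t.2.1 t.2.2 := by
  constructor
  · have key : ∀ t ∈ fccNbr, FccAdj t.1 t.2.1 t.2.2 := by decide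
    exact key t
  · obtain ⟨r, P, Q⟩ := t
    intro h
    have hr : r ∈ ({0, 1, -1} : Finset ℤ) := by
      rcases h with ⟨rfl, -⟩ | ⟨rfl, -⟩ | ⟨rfl, -⟩ <;> decide
    have hPQ : (P, Q) ∈ sixOffsets ∪ threeOffsets (-1) ∪ threeOffsets 1 := by
      rcases h with ⟨-, h⟩ | ⟨-, h⟩ | ⟨-, h⟩ <;> simp [h]
    have key : ∀ r' ∈ ({0, 1, -1} : Finset ℤ),
        ∀ PQ ∈ sixOffsets ∪ threeOffsets (-1) ∪ threeOffsets 1,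
          FccAdj r' PQ.1 PQ.2 → (r', PQ) ∈ fccNbr := by
      decide
    exact key r hr (P, Q) hPQ h

/-- Number of common bonded neighbours, in the FCC stacking, of two points with index difference
`d = (kq − kp, iq − ip, jq − jp)`: the bond offsets `t` from `p` whose endpoint is also bonded to
`q`. [folklore] -/
def fccCommonCount (d : ℤ × ℤ × ℤ) : ℕ :=
  (fccNbr.filter fun t => FccAdj (t.1 - d.1) (d.2.1 + t.2.1) (d.2.2 + t.2.2)).card

/-- **In the FCC bond graph no two distinct non-bonded points have exactly three common
neighbours** (the values are `4, 2, 1, 0`): the finite check over all index differences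
`d` admitting a common neighbour at all, i.e. `d = (t.1 − t'.1, t'.2.1 − t.2.1, t'.2.2 − t.2.2)`
for bond offsets `t, t'`. [folklore] -/
theorem fccCommonCount_ne_three_aux :
    ∀ t ∈ fccNbr, ∀ t' ∈ fccNbr,
      (t.1 - t'.1, t'.2.1 - t.2.1, t'.2.2 - t.2.2) ≠ ((0 : ℤ), (0 : ℤ), (0 : ℤ)) →
      ¬ FccAdj (t.1 - t'.1) (-(t'.2.1 - t.2.1)) (-(t'.2.2 - t.2.2)) →
      fccCommonCount (t.1 - t'.1, t'.2.1 - t.2.1, t'.2.2 - t.2.2) ≠ 3 := by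
  decide


/-- Hence: `fccCommonCount d ≠ 3` whenever `d ≠ 0` is not a bond offset. [folklore] -/
theorem fccCommonCount_ne_three {d : ℤ × ℤ × ℤ} (hd : d ≠ ((0 : ℤ), (0 : ℤ), (0 : ℤ)))
    (hnb : ¬ FccAdj d.1 (-d.2.1) (-d.2.2)) : fccCommonCount d ≠ 3 := by
  classical
  by_cases hex : ∃ t ∈ fccNbr, FccAdj (t.1 - d.1) (d.2.1 + t.2.1) (d.2.2 + t.2.2)
  · obtain ⟨t, ht, hadj⟩ := hex
    have ht' : (t.1 - d.1, d.2.1 + t.2.1, d.2.2 + t.2.2) ∈ fccNbr := mem_fccNbr_iff.2 hadj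
    have key := fccCommonCount_ne_three_aux t ht _ ht'
    have e : (t.1 - (t.1 - d.1), d.2.1 + t.2.1 - t.2.1, d.2.2 + t.2.2 - t.2.2) = d := by
      obtain ⟨a, b, c⟩ := d
      simp only [Prod.mk.injEq]
      refine ⟨by ring, by ring, by ring⟩
    simp only [e] at key
    obtain ⟨a, b, c⟩ := d
    simp only [show t.1 - (t.1 - a) = a by ring, show -(b + t.2.1 - t.2.1) = -b by ring,
      show -(c + t.2.2 - t.2.2) = -c by ring] at key
    exact key hd hnb
  · have hempty : (fccNbr.filter fun t => FccAdj (t.1 - d.1) (d.2.1 + t.2.1) (d.2.2 + t.2.2)) = ∅ :=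
      Finset.filter_eq_empty_iff.2 fun t ht hadj => hex ⟨t, ht, hadj⟩
    simp [fccCommonCount, hempty]

/-- The FCC source of the chart, `barlowStacking 1 √(2/3) constHagg`. [folklore] -/
theorem sqrt_two_thirds_sq : Real.sqrt (2 / 3) ^ 2 = 2 / 3 * (1 : ℝ) ^ 2 := by
  rw [Real.sq_sqrt (by norm_num)]; ring

/-- **Bonds of the FCC stacking in stacking coordinates.** [cite: HalesDSP2012, §1.3] -/
theorem fcc_dist_eq_one_iff (kp ip jp k i j : ℤ) :
    dist (barlowPos 1 (Real.sqrt (2 / 3)) constHagg kp ip jp)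
        (barlowPos 1 (Real.sqrt (2 / 3)) constHagg k i j) = 1 ↔ FccAdj (k - kp) (ip - i) (jp - j) := by
  rw [dist_barlowPos_eq_iff isHaggSeq_const one_pos sqrt_two_thirds_sq]
  simp only [constHagg, FccAdj]
  constructor
  · rintro (⟨hk, hm⟩ | ⟨hk, hm⟩ | ⟨hk, hm⟩)
    · exact Or.inl ⟨by omega, hm⟩
    · exact Or.inr (Or.inl ⟨by omega, hm⟩)
    · exact Or.inr (Or.inr ⟨by omega, hm⟩)
  · rintro (⟨hk, hm⟩ | ⟨hk, hm⟩ | ⟨hk, hm⟩)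
    · exact Or.inl ⟨by omega, hm⟩
    · exact Or.inr (Or.inl ⟨by omega, hm⟩)
    · exact Or.inr (Or.inr ⟨by omega, hm⟩)

/-- Index injectivity of the FCC stacking. [folklore] -/
theorem fcc_barlowPos_injective {k i j k' i' j' : ℤ}
    (h : barlowPos 1 (Real.sqrt (2 / 3)) constHagg k i j =
      barlowPos 1 (Real.sqrt (2 / 3)) constHagg k' i' j') : (k, i, j) = (k', i', j') := by
  by_contra hne
  have h1 := le_dist_barlowPos_of_ideal isHaggSeq_const one_pos sqrt_two_thirds_sq hne
  rw [h, dist_self] at h1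
  exact absurd h1 (by norm_num)

/-- **Common neighbours in the FCC stacking are counted by `fccCommonCount`.** [folklore] -/
theorem ncard_common_fcc (kp ip jp kq iq jq : ℤ) :
    {w : E3 | w ∈ barlowStacking 1 (Real.sqrt (2 / 3)) constHagg ∧
        dist (barlowPos 1 (Real.sqrt (2 / 3)) constHagg kp ip jp) w = 1 ∧
        dist (barlowPos 1 (Real.sqrt (2 / 3)) constHagg kq iq jq) w = 1}.ncard =
      fccCommonCount (kq - kp, iq - ip, jq - jp) := by
  classical
  let g : ℤ × ℤ × ℤ → E3 := fun t =>
    barlowPos 1 (Real.sqrt (2 / 3)) constHagg (kp + t.1) (ip - t.2.1) (jp - t.2.2)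
  have hset : {w : E3 | w ∈ barlowStacking 1 (Real.sqrt (2 / 3)) constHagg ∧
        dist (barlowPos 1 (Real.sqrt (2 / 3)) constHagg kp ip jp) w = 1 ∧
        dist (barlowPos 1 (Real.sqrt (2 / 3)) constHagg kq iq jq) w = 1} =
      g '' ↑(fccNbr.filter fun t : ℤ × ℤ × ℤ =>
        FccAdj (t.1 - (kq - kp)) ((iq - ip) + t.2.1) ((jq - jp) + t.2.2)) := by
    ext w
    simp only [Set.mem_setOf_eq, Set.mem_image, Finset.coe_filter]
    constructor
    · rintro ⟨⟨k, i, j, rfl⟩, hp, hq⟩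
      rw [fcc_dist_eq_one_iff] at hp hq
      refine ⟨(k - kp, ip - i, jp - j), ⟨mem_fccNbr_iff.2 hp, ?_⟩, ?_⟩
      · have e1 : k - kp - (kq - kp) = k - kq := by ring
        have e2 : iq - ip + (ip - i) = iq - i := by ring
        have e3 : jq - jp + (jp - j) = jq - j := by ring
        show FccAdj (k - kp - (kq - kp)) (iq - ip + (ip - i)) (jq - jp + (jp - j))
        rw [e1, e2, e3]
        exact hq
      · show barlowPos 1 (Real.sqrt (2 / 3)) constHagg (kp + (k - kp)) (ip - (ip - i)) (jp - (jp - j)) = _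
        congr 1 <;> ring
    · rintro ⟨t, ⟨ht, hadj⟩, rfl⟩
      refine ⟨barlowPos_mem _ _ _, ?_, ?_⟩
      · show dist _ (barlowPos 1 (Real.sqrt (2 / 3)) constHagg (kp + t.1) (ip - t.2.1) (jp - t.2.2)) = 1
        rw [fcc_dist_eq_one_iff]
        have e1 : kp + t.1 - kp = t.1 := by ring
        have e2 : ip - (ip - t.2.1) = t.2.1 := by ring
        have e3 : jp - (jp - t.2.2) = t.2.2 := by ring
        rw [e1, e2, e3]
        exact mem_fccNbr_iff.1 ht
      · show dist _ (barlowPos 1 (Real.sqrt (2 / 3)) constHagg (kp + t.1) (ip - t.2.1) (jp - t.2.2)) = 1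
        rw [fcc_dist_eq_one_iff]
        have e1 : kp + t.1 - kq = t.1 - (kq - kp) := by ring
        have e2 : iq - (ip - t.2.1) = iq - ip + t.2.1 := by ring
        have e3 : jq - (jp - t.2.2) = jq - jp + t.2.2 := by ring
        rw [e1, e2, e3]
        exact hadj
  have hinj : Set.InjOn g ↑(fccNbr.filter fun t : ℤ × ℤ × ℤ =>
      FccAdj (t.1 - (kq - kp)) ((iq - ip) + t.2.1) ((jq - jp) + t.2.2)) := by
    rintro ⟨a, b, c⟩ - ⟨a', b', c'⟩ - htt
    have key := fcc_barlowPos_injective htt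
    simp only [Prod.mk.injEq] at key
    simp only [Prod.mk.injEq]
    omega
  rw [hset, hinj.ncard_image, Set.ncard_coe_finset]
  rfl

/-- The strengthening of the conclusion with the Hägg word FIXED to `constHagg` (FCC): `S` is
bond-isomorphic to the FCC stacking. [folklore] -/
def FccChart (S : Set E3) : Prop :=
  ∃ Φ : E3 → E3, Set.BijOn Φ (barlowStacking 1 (Real.sqrt (2 / 3)) constHagg) S ∧
    ∀ p ∈ barlowStacking 1 (Real.sqrt (2 / 3)) constHagg,
      ∀ q ∈ barlowStacking 1 (Real.sqrt (2 / 3)) constHagg,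
        (dist p q = 1 ↔ (0 < dist (Φ p) (Φ q) ∧ dist (Φ p) (Φ q) ≤ 28 / 25))

/-- An FCC chart is a Barlow chart (with `s = constHagg`). [folklore] -/
theorem FccChart.barlowChart {S : Set E3} (h : FccChart S) : BarlowChart S :=
  ⟨constHagg, isHaggSeq_const, h⟩

/-- `28/25 < √2`. [folklore] -/
theorem bondWindow_lt_sqrt_two : (28 / 25 : ℝ) < Real.sqrt 2 * 1 := by
  rw [mul_one, show (28 / 25 : ℝ) = Real.sqrt ((28 / 25) ^ 2) by rw [Real.sqrt_sq]; norm_num]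
  exact Real.sqrt_lt_sqrt (by norm_num) (by norm_num)

/-- **The Hägg word is load-bearing: an FCC chart does not always exist.**  The ideal HCP stacking
(scale `1`) satisfies the hypothesis of the crux, but is not bond-isomorphic to the FCC stacking:
its points `u = (layer 1, 0, 0)` and `l = (layer −1, 0, 0)` — mirror images across layer `0` —
are not bonded (`dist u l = 2√(2/3) > 28/25`) and have exactly three common bonded neighbours
(the triangle of layer `0` below/above them), while two distinct non-bonded points of the FCC
stacking never have exactly three (`fccCommonCount_ne_three`). [folklore] -/
theorem not_shellsToFccChart :
    ¬ ∀ S : Set E3, S.Nonempty → (∀ x ∈ S, GoodShellAt (9 / 10) 1 S x) → FccChart S := by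
  classical
  intro h
  have hyp := hypothesis_barlowStacking isHaggSeq_alternating (c := 1) (by norm_num) le_rfl
  obtain ⟨Φ, hbij, hiff⟩ := h _ hyp.1 hyp.2
  set B := barlowStacking 1 (Real.sqrt (2 / 3)) constHagg with hB
  set H := barlowStacking 1 (1 * Real.sqrt (2 / 3)) alternatingHagg with hH
  have hh1 : (1 * Real.sqrt (2 / 3)) ^ 2 = 2 / 3 * (1 : ℝ) ^ 2 := ideal_sq 1
  have hs := isHaggSeq_alternating
  have ha0 : alternatingHagg 0 = 1 := by simp [alternatingHagg]
  have ha1 : alternatingHagg (-1) = -1 := by decide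
  -- the five HCP points
  set u : E3 := barlowPos 1 (1 * Real.sqrt (2 / 3)) alternatingHagg 1 0 0 with hu
  set l : E3 := barlowPos 1 (1 * Real.sqrt (2 / 3)) alternatingHagg (-1) 0 0 with hl
  have huH : u ∈ H := barlowPos_mem _ _ _
  have hlH : l ∈ H := barlowPos_mem _ _ _
  have hul : u ≠ l := by
    intro e
    have := le_dist_barlowPos_of_ideal hs one_pos hh1 (k := 1) (i := 0) (j := 0) (k' := -1)
      (i' := 0) (j' := 0) (by decide)
    rw [← hu, ← hl, e, dist_self] at this
    norm_num at this
  have hul1 : dist u l ≠ 1 := by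
    intro h1
    rw [hu, hl, dist_barlowPos_eq_iff hs one_pos hh1] at h1
    rcases h1 with ⟨hk, -⟩ | ⟨hk, -⟩ | ⟨hk, -⟩ <;> omega
  -- `u, l` are not a window pair
  have hwin : ¬ (0 < dist u l ∧ dist u l ≤ 28 / 25) := by
    rintro ⟨-, hle⟩
    exact hul1 (dist_eq_of_dist_le_of_lt hs one_pos hh1 huH hlH hul bondWindow_lt_sqrt_two hle)
  -- common neighbours of `u, l` in `H` lie in layer `0` at offsets `(0,0), (1,0), (0,1)`
  have hcommon : ∀ w ∈ H, dist u w = 1 → dist l w = 1 →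
      w = barlowPos 1 (1 * Real.sqrt (2 / 3)) alternatingHagg 0 0 0 ∨
      w = barlowPos 1 (1 * Real.sqrt (2 / 3)) alternatingHagg 0 1 0 ∨
      w = barlowPos 1 (1 * Real.sqrt (2 / 3)) alternatingHagg 0 0 1 := by
    rintro w ⟨k, i, j, rfl⟩ hwu hwl
    rw [hu, dist_barlowPos_eq_iff hs one_pos hh1] at hwu
    rw [hl, dist_barlowPos_eq_iff hs one_pos hh1] at hwl
    have hk : k = 0 := by
      rcases hwu with ⟨hk, -⟩ | ⟨hk, -⟩ | ⟨hk, -⟩ <;> rcases hwl with ⟨hk', -⟩ | ⟨hk', -⟩ | ⟨hk', -⟩ <;>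
        omega
    subst hk
    rcases hwu with ⟨hk, -⟩ | ⟨hk, -⟩ | ⟨-, hm⟩
    · omega
    · omega
    · rw [show (1 : ℤ) - 1 = 0 by norm_num, ha0] at hm
      simp only [threeOffsets, if_true, Finset.mem_insert, Finset.mem_singleton, Prod.mk.injEq] at hm
      rcases hm with ⟨hi, hj⟩ | ⟨hi, hj⟩ | ⟨hi, hj⟩
      · left; congr 1 <;> omega
      · right; left; congr 1 <;> omega
      · right; right; congr 1 <;> omega
  -- pull back to the FCC stacking
  obtain ⟨p, hpB, hpu⟩ := hbij.surjOn huH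
  obtain ⟨q, hqB, hql⟩ := hbij.surjOn hlH
  have hpq1 : dist p q ≠ 1 := by
    intro h1
    have := (hiff p hpB q hqB).1 h1
    rw [hpu, hql] at this
    exact hwin this
  have hpq : p ≠ q := by
    intro e
    apply hul
    rw [← hpu, ← hql, e]
  -- the three common neighbours of `u, l` and their preimages
  set c0 : E3 := barlowPos 1 (1 * Real.sqrt (2 / 3)) alternatingHagg 0 0 0 with hc0
  set c1 : E3 := barlowPos 1 (1 * Real.sqrt (2 / 3)) alternatingHagg 0 1 0 with hc1
  set c2 : E3 := barlowPos 1 (1 * Real.sqrt (2 / 3)) alternatingHagg 0 0 1 with hc2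
  have hne : ∀ {k i j k' i' j' : ℤ}, (k, i, j) ≠ (k', i', j') →
      barlowPos 1 (1 * Real.sqrt (2 / 3)) alternatingHagg k i j ≠
        barlowPos 1 (1 * Real.sqrt (2 / 3)) alternatingHagg k' i' j' := by
    intro k i j k' i' j' hidx e
    have := le_dist_barlowPos_of_ideal hs one_pos hh1 hidx
    rw [e, dist_self] at this
    norm_num at this
  have h01 : c0 ≠ c1 := hne (by decide)
  have h02 : c0 ≠ c2 := hne (by decide)
  have h12 : c1 ≠ c2 := hne (by decide)
  -- `u, l` are bonded to `c0, c1, c2`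
  have hdu : ∀ c ∈ ({c0, c1, c2} : Set E3), dist u c = 1 ∧ dist l c = 1 := by
    intro c hc
    simp only [Set.mem_insert_iff, Set.mem_singleton_iff] at hc
    rcases hc with rfl | rfl | rfl
    · exact ⟨(dist_barlowPos_eq_iff hs one_pos hh1 1 0 0 0 0 0).2 (Or.inr (Or.inr (by decide))),
        (dist_barlowPos_eq_iff hs one_pos hh1 (-1) 0 0 0 0 0).2 (Or.inr (Or.inl (by decide)))⟩
    · exact ⟨(dist_barlowPos_eq_iff hs one_pos hh1 1 0 0 0 1 0).2 (Or.inr (Or.inr (by decide))),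
        (dist_barlowPos_eq_iff hs one_pos hh1 (-1) 0 0 0 1 0).2 (Or.inr (Or.inl (by decide)))⟩
    · exact ⟨(dist_barlowPos_eq_iff hs one_pos hh1 1 0 0 0 0 1).2 (Or.inr (Or.inr (by decide))),
        (dist_barlowPos_eq_iff hs one_pos hh1 (-1) 0 0 0 0 1).2 (Or.inr (Or.inl (by decide)))⟩
  have hcH : ∀ c ∈ ({c0, c1, c2} : Set E3), c ∈ H := by
    intro c hc
    simp only [Set.mem_insert_iff, Set.mem_singleton_iff] at hc
    rcases hc with rfl | rfl | rfl <;> exact barlowPos_mem _ _ _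
  -- preimage of a common neighbour is a common neighbour of `p, q`
  have hpre : ∀ c ∈ ({c0, c1, c2} : Set E3), ∀ r ∈ B, Φ r = c → dist p r = 1 ∧ dist q r = 1 := by
    intro c hc r hrB hrc
    obtain ⟨d1, d2⟩ := hdu c hc
    refine ⟨(hiff p hpB r hrB).2 ?_, (hiff q hqB r hrB).2 ?_⟩
    · rw [hpu, hrc, d1]; norm_num
    · rw [hql, hrc, d2]; norm_num
  obtain ⟨r0, hr0B, hr0⟩ := hbij.surjOn (hcH c0 (by simp))
  obtain ⟨r1, hr1B, hr1⟩ := hbij.surjOn (hcH c1 (by simp))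
  obtain ⟨r2, hr2B, hr2⟩ := hbij.surjOn (hcH c2 (by simp))
  have hr01 : r0 ≠ r1 := by intro e; apply h01; rw [← hr0, ← hr1, e]
  have hr02 : r0 ≠ r2 := by intro e; apply h02; rw [← hr0, ← hr2, e]
  have hr12 : r1 ≠ r2 := by intro e; apply h12; rw [← hr1, ← hr2, e]
  -- the common-neighbour set of `p, q` in `B` is `{r0, r1, r2}`
  set N := {w : E3 | w ∈ B ∧ dist p w = 1 ∧ dist q w = 1} with hN
  have hNeq : N = {r0, r1, r2} := by
    ext w
    simp only [hN, Set.mem_setOf_eq, Set.mem_insert_iff, Set.mem_singleton_iff]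
    constructor
    · rintro ⟨hwB, hpw, hqw⟩
      have h1 := (hiff p hpB w hwB).1 hpw
      have h2 := (hiff q hqB w hwB).1 hqw
      rw [hpu] at h1
      rw [hql] at h2
      have hwH : Φ w ∈ H := hbij.mapsTo hwB
      have hne1 : u ≠ Φ w := by intro e; rw [← e, dist_self] at h1; exact lt_irrefl _ h1.1
      have hne2 : l ≠ Φ w := by intro e; rw [← e, dist_self] at h2; exact lt_irrefl _ h2.1
      have d1 := dist_eq_of_dist_le_of_lt hs one_pos hh1 huH hwH hne1 bondWindow_lt_sqrt_two h1.2
      have d2 := dist_eq_of_dist_le_of_lt hs one_pos hh1 hlH hwH hne2 bondWindow_lt_sqrt_two h2.2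
      rcases hcommon _ hwH d1 d2 with e | e | e
      · left; exact hbij.injOn hwB hr0B (by rw [e, hr0])
      · right; left; exact hbij.injOn hwB hr1B (by rw [e, hr1])
      · right; right; exact hbij.injOn hwB hr2B (by rw [e, hr2])
    · rintro (rfl | rfl | rfl)
      · exact ⟨hr0B, hpre c0 (by simp) _ hr0B hr0⟩
      · exact ⟨hr1B, hpre c1 (by simp) _ hr1B hr1⟩
      · exact ⟨hr2B, hpre c2 (by simp) _ hr2B hr2⟩
  have hN3 : N.ncard = 3 := by
    rw [hNeq]
    exact Set.ncard_eq_three.2 ⟨r0, r1, r2, hr01, hr02, hr12, rfl⟩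
  -- but in the FCC stacking the count is never three
  obtain ⟨kp, ip, jp, rfl⟩ := hpB
  obtain ⟨kq, iq, jq, rfl⟩ := hqB
  rw [hN, ncard_common_fcc] at hN3
  refine fccCommonCount_ne_three ?_ ?_ hN3
  · intro hd0
    simp only [Prod.mk.injEq] at hd0
    apply hpq
    congr 1 <;> omega
  · intro hadj
    apply hpq1
    rw [fcc_dist_eq_one_iff]
    convert hadj using 2 <;> ring

end HaggWord


end Summit.AtomisticToContinuum.Crystallization.Theorems.ShellsToBarlowChartNegative
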